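import Summits.NavierStokesRegularity.NavierStokesRegularity.Theses.AxisymmetricExtremality
import Summits.NavierStokesRegularity.NavierStokesRegularity.Theorems.AxisymmetricExtremalityAxisymmetricKatoGlobalNoSwirlStratum
import Summits.NavierStokesRegularity.NavierStokesRegularity.Theorems.AxisymmetricExtremalityAxisymmetricKatoGlobalReduction
import Literature.Analysis.FluidPDE.AxisymmetricReflection
import Literature.Analysis.FluidPDE.AxisymmetricTypeIBounded
import HarnessLib.Audit

/-!
# Strategist census `-s13` — kernel-checked exhibits (crux `AxisymmetricExtremality.AxisymmetricKatoGlobal`,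
item `stmt-NavierStokesRegularity-15453`)

Companion of `Cruxes/AxisymmetricKatoGlobal/STRATEGY-CENSUS-s13.md` (second, independent census,
family `-s`).  Nothing here is a line or a stub; every theorem is sorry-free and only CERTIFIES the
census claims:

* `NoAxisymMinimalDatum` (W1) is the threshold instance of the crux that `closes` actually consumes;
  `closes_W1` is the alternative glue `MinimalDatumPFold → PFoldToAxisymmetric → W1 → Clay (A)`
  (pure logic) and `noAxisymMinimalDatum_of_crux` the trivial direction `AX_H → W1`.
* `no_O2_minimalBlowupDatum`: the `O(2)`-fixed locus of the Rusin–Šverák moduli space is EMPTY —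
  an axisymmetric minimal blow-up datum that is also equivariant under the reflection `reflY`
  (`(x₀,x₁,x₂) ↦ (x₀,−x₁,x₂)`) is swirl-free (`IsAxisymmetric.hasNoSwirl_of_reflY_eq`), hence global
  by the LANDED no-swirl stratum (`axisymmetricKatoGlobal_noSwirl_stratum`), contradicting minimality.
* `minimalDatumO2_iff_summit`: consequently the "bypass" crux `MinimalDatumO2` (under Clay failure
  some minimal blow-up datum is `O(2)`-symmetric — the output an `O(2)`/dihedral Smith-type
  fixed-point argument would have to deliver so that the no-swirl THEOREM replaces AX_H) is
  LITERALLY EQUIVALENT to the summit `NavierStokesRegularity`: a costume, not a weaker intermediate;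
  and its Rusin–Šverák form `MinimalDatumO2Pure` is equivalent to `ρ_max^pure = ⊤` for all `ν`
  (critical-space regularity, which implies the crux outright: `crux_of_rhoMaxPure_top`).
* `EpsSwirlRegularity` (B1, the rate-free endpoint of the Lei–Zhang/Wei/Seregin ladder) and
  `EpsSwirlDepletion` (B2, a-priori ε-depletion of the swirl at the axis up to the maximal time)
  with the PROVED assembly `AxisymmetricKatoGlobal_of_epsSplit : B1 → B2 → crux` (via the landed
  stub `stub_katoAxisymSingularPoint`): the best typed 2-piece decomposition found — recorded, not
  registered (B2 carries the whole difficulty; see the census).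
-/

noncomputable section

-- the summit and its single problem share the name (D-0017 nested layout)
set_option linter.dupNamespace false
set_option linter.unusedVariables false

open Set MeasureTheory Filter Topology Function Metric
open scoped ENNReal NNReal
open Literature.Analysis.FluidPDE Literature.Analysis.FunctionSpaces

namespace Summit.NavierStokesRegularity.NavierStokesRegularity.Cruxes.AxisymmetricKatoGlobal.StrategistS13

local notation "ℝ³" => EuclideanSpace ℝ (Fin 3)
local notation "ℂ³" => EuclideanSpace ℂ (Fin 3)

/-! ## 1. Weaker intermediate W1 — the threshold instance -/

/-- **W1.** No axisymmetric MINIMAL blow-up datum (Rusin–Šverák threshold `‖g‖_{Ḣ^{1/2}} = ρ_max^pure`). -/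
def NoAxisymMinimalDatum : Prop :=
  ∀ ν : ℝ, 0 < ν → ∀ (u₀ : ℝ³ → ℝ³) (g : HomSobolev ℝ³ ℂ³ (1 / 2 : ℝ)),
    IsMinimalBlowupDatum ν u₀ g → IsAxisymmetric u₀ → False

/-- `AX_H → W1` (W1 is formally weaker: it is the crux restricted to the threshold sphere). -/
theorem noAxisymMinimalDatum_of_crux (h : Theses.AxisymmetricExtremality.AxisymmetricKatoGlobal) :
    NoAxisymMinimalDatum := by
  intro ν hν u₀ g hmin hax
  obtain ⟨hL3, hrep, hdiv, -, hnot⟩ := hmin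
  exact hnot (h ν hν u₀ g hL3 hrep hdiv (fun θ x => hax θ x))

/-- **Alternative glue.** W1 may replace AX_H in the route's deciding theorem: pure logic. -/
theorem closes_W1 (h₂ : Theses.AxisymmetricExtremality.MinimalDatumPFold)
    (h₄ : Theses.AxisymmetricExtremality.PFoldToAxisymmetric) (hW : NoAxisymMinimalDatum) :
    NavierStokesRegularity := by
  show Literature.NS.NavierStokesExistenceSmoothR3
  intro ν hν u₀ hsm hdiv hdec
  by_contra hno
  obtain ⟨u₁, g, hmin, hax⟩ := h₄ ν hν (h₂ ν hν ⟨u₀, hsm, hdiv, hdec, hno⟩)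
  exact hW ν hν u₁ g hmin (fun θ x => hax θ x)

/-! ## 2. The O(2) bypass is a costume -/

/-- Clay (A) fails at viscosity `ν` (verbatim the antecedent of `MinimalDatumPFold`). -/
def ClayFailsAt (ν : ℝ) : Prop :=
  ∃ v₀ : ℝ³ → ℝ³, ContDiff ℝ (⊤ : ℕ∞) v₀ ∧ NSWave0.IsDivFree v₀ ∧ HasRapidSpatialDecay v₀ ∧
    ¬ ∃ (u : ℝ → ℝ³ → ℝ³) (p : ℝ → ℝ³ → ℝ), IsSmoothOnHalfSpace u ∧ IsSmoothOnHalfSpace p ∧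
      IsNavierStokesSolution ν 0 v₀ u p ∧ HasBoundedEnergy u

/-- **The `O(2)`-fixed locus of `M̂(ν)` is empty** (for every `ν > 0`): an axisymmetric minimal blow-up
datum cannot be `reflY`-equivariant, because it would be swirl-free and hence global by the landed
no-swirl stratum. -/
theorem no_O2_minimalBlowupDatum :
    ∀ ν : ℝ, 0 < ν → ∀ (u₀ : ℝ³ → ℝ³) (g : HomSobolev ℝ³ ℂ³ (1 / 2 : ℝ)),
      IsMinimalBlowupDatum ν u₀ g → IsAxisymmetric u₀ → (∀ x, u₀ (reflY x) = reflY (u₀ x)) →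
        False := by
  intro ν hν u₀ g hmin hax hσ
  obtain ⟨hL3, hrep, hdiv, -, hnot⟩ := hmin
  exact hnot (Theorems.AxisymmetricKatoGlobal.NoSwirlStratum.axisymmetricKatoGlobal_noSwirl_stratum
    ν hν u₀ hL3 hdiv (fun θ x => hax θ x) (hax.hasNoSwirl_of_reflY_eq hσ))

/-- **The bypass crux** an `O(2)`/dihedral fixed-point argument would have to deliver: under Clay
failure some minimal blow-up datum is axisymmetric AND `reflY`-equivariant. -/
def MinimalDatumO2 : Prop :=
  ∀ ν : ℝ, 0 < ν → ClayFailsAt ν → ∃ (u₀ : ℝ³ → ℝ³) (g : HomSobolev ℝ³ ℂ³ (1 / 2 : ℝ)),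
    IsMinimalBlowupDatum ν u₀ g ∧ IsAxisymmetric u₀ ∧ ∀ x, u₀ (reflY x) = reflY (u₀ x)

/-- The bypass glue: `MinimalDatumO2` alone decides Clay (A) — no AX_H needed. -/
theorem closes_O2 (h : MinimalDatumO2) : NavierStokesRegularity := by
  show Literature.NS.NavierStokesExistenceSmoothR3
  intro ν hν u₀ hsm hdiv hdec
  by_contra hno
  obtain ⟨u₁, g, hmin, hax, hσ⟩ := h ν hν ⟨u₀, hsm, hdiv, hdec, hno⟩
  exact no_O2_minimalBlowupDatum ν hν u₁ g hmin hax hσ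

/-- **Costume certificate.** The bypass crux is literally equivalent to the summit. -/
theorem minimalDatumO2_iff_summit : MinimalDatumO2 ↔ NavierStokesRegularity := by
  refine ⟨closes_O2, fun hS ν hν hfail => ?_⟩
  obtain ⟨v₀, hsm, hdiv, hdec, hno⟩ := hfail
  exact absurd (hS ν hν v₀ hsm hdiv hdec) hno

/-- Rusin–Šverák form of the bypass (antecedent = finite threshold instead of Clay failure). -/
def MinimalDatumO2Pure : Prop :=
  ∀ ν : ℝ, 0 < ν → rusinSverakRhoMaxPure ν < ⊤ → ∃ (u₀ : ℝ³ → ℝ³) (g : HomSobolev ℝ³ ℂ³ (1 / 2 : ℝ)),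
    IsMinimalBlowupDatum ν u₀ g ∧ IsAxisymmetric u₀ ∧ ∀ x, u₀ (reflY x) = reflY (u₀ x)

/-- … which is equivalent to CRITICAL-SPACE regularity `ρ_max^pure(ν) = ⊤` for every `ν > 0`. -/
theorem minimalDatumO2Pure_iff :
    MinimalDatumO2Pure ↔ ∀ ν : ℝ, 0 < ν → rusinSverakRhoMaxPure ν = ⊤ := by
  constructor
  · intro h ν hν
    by_contra hne
    obtain ⟨u₀, g, hmin, hax, hσ⟩ := h ν hν (lt_top_iff_ne_top.2 hne)
    exact no_O2_minimalBlowupDatum ν hν u₀ g hmin hax hσ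
  · intro h ν hν hlt
    exact absurd (h ν hν) hlt.ne

/-- … and `ρ_max^pure = ⊤` gives the crux outright (every represented datum is below threshold). -/
theorem crux_of_rhoMaxPure_top (h : ∀ ν : ℝ, 0 < ν → rusinSverakRhoMaxPure ν = ⊤) :
    Theses.AxisymmetricExtremality.AxisymmetricKatoGlobal := by
  intro ν hν u₀ g hL3 hrep hdiv _hax
  exact hasGlobalKatoSolution_of_lt_rusinSverakRhoMaxPure hL3 hrep hdiv (by rw [h ν hν]; exact enorm_lt_top)

/-! ## 3. The best typed decomposition (D-B): rate-free ε-criterion + a-priori ε-depletion -/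

/-- **B1 — `EpsSwirlRegularity`** (the exponent-`0` endpoint of the swirl-modulus ladder, in the Kato
class, local at the top time): a universal `ε > 0` such that an axisymmetric Kato solution on
`[0,T)`, smooth inside, whose swirl obeys `|Γ| ≤ ε ν` for `cylRadius ≤ δ₀` uniformly on some
`[t₀, T)`, is bounded near `(T, x₀)` for every `x₀`.  OPEN (known only with a rate:
`|ln r|^{-2}` Lei–Zhang 2017, `|ln r|^{-3/2}` Wei 2016, local `ln^{-3}` Seregin 2022). -/
def EpsSwirlRegularity : Prop :=
  ∃ ε : ℝ, 0 < ε ∧ ∀ ν : ℝ, 0 < ν → ∀ T : ℝ, 0 < T → ∀ (u₀ : ℝ³ → ℝ³) (u : ℝ → ℝ³ → ℝ³),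
    IsKatoSolutionOn T ν u₀ u → ContDiffOn ℝ (⊤ : ℕ∞) (uncurry u) (Ioo 0 T ×ˢ univ) →
    (∀ t ∈ Ioo 0 T, IsAxisymmetric (u t)) →
    (∃ t₀ ∈ Ioo 0 T, ∃ δ₀ : ℝ, 0 < δ₀ ∧
        ∀ t ∈ Ico t₀ T, ∀ x : ℝ³, cylRadius x ≤ δ₀ → |swirl (u t) x| ≤ ε * ν) →
    ∀ x₀ : ℝ³, IsBoundedNearTop u T x₀

/-- **B2 — `EpsSwirlDepletion`** (a-priori): for every `ε > 0`, the swirl of an axisymmetric Kato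
solution from an `Ḣ^{1/2}`-represented datum is `≤ ε ν` on a thin enough tube around the axis,
uniformly up to the final time.  Trivial below the lifespan; at `T = T_max` it is the statement that
swirl cannot concentrate at a singular axis point — violated by every tornado-type scenario. -/
def EpsSwirlDepletion : Prop :=
  ∀ ε : ℝ, 0 < ε → ∀ ν : ℝ, 0 < ν → ∀ T : ℝ, 0 < T → ∀ (u₀ : ℝ³ → ℝ³)
    (g : HomSobolev ℝ³ ℂ³ (1 / 2 : ℝ)) (u : ℝ → ℝ³ → ℝ³),
    g.Represents (Literature.Analysis.FunctionSpaces.EuclideanSpace.complexify ∘ u₀) →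
    IsKatoSolutionOn T ν u₀ u → ContDiffOn ℝ (⊤ : ℕ∞) (uncurry u) (Ioo 0 T ×ˢ univ) →
    (∀ t ∈ Ioo 0 T, IsAxisymmetric (u t)) →
    ∀ t₀ ∈ Ioo 0 T, ∃ δ₀ : ℝ, 0 < δ₀ ∧
      ∀ t ∈ Ico t₀ T, ∀ x : ℝ³, cylRadius x ≤ δ₀ → |swirl (u t) x| ≤ ε * ν

/-- **Assembly of D-B, proved:** `B1 → B2 → crux` (by name), through the landed stub
`stub_katoAxisymSingularPoint` and the landed cylinder lemma. -/
theorem AxisymmetricKatoGlobal_of_epsSplit (hB1 : EpsSwirlRegularity) (hB2 : EpsSwirlDepletion) :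
    Theses.AxisymmetricExtremality.AxisymmetricKatoGlobal := by
  obtain ⟨ε, hε, hreg⟩ := hB1
  intro ν hν u₀ g hL3 hrep hdiv hax
  have hax' : IsAxisymmetric u₀ := fun θ x => hax θ x
  by_contra hng
  obtain ⟨T, hT, xs, u, hK, hsm, haxi, hsing⟩ :=
    Theorems.AxisymmetricKatoGlobal.Registered.stub_katoAxisymSingularPoint ν hν u₀ hL3 hdiv hax' hng
  have ht₀ : T / 2 ∈ Ioo 0 T := ⟨by linarith, by linarith⟩
  obtain ⟨δ₀, hδ₀, hmod⟩ := hB2 ε hε ν hν T hT u₀ g u hrep hK hsm haxi (T / 2) ht₀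
  obtain ⟨r, hr, K, hbd⟩ := hreg ν hν T hT u₀ u hK hsm haxi ⟨T / 2, ht₀, δ₀, hδ₀, hmod⟩ xs
  exact absurd (hsing r hr)
    (Theorems.AxisymmetricKatoGlobal.Registered.eLpNorm_parabolicCylinder_lt_top_of_forall_le hbd).ne

/-- Neither piece is the summit by `Iff.rfl`-type triviality, but B2 with `ε` replaced by the
log-cube modulus is verbatim the registered `stub_swirlAxisModulus` weakened (constant instead of a
decaying modulus), and B1 is the registered criterion `logSwirlRegularity` strengthened (rate
removed): the split only moves difficulty from the proved piece to the open one.  Recorded for the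
census; NOT registered as a line. -/
theorem epsSplit_recorded : True := trivial

end Summit.NavierStokesRegularity.NavierStokesRegularity.Cruxes.AxisymmetricKatoGlobal.StrategistS13
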